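import Summits.BirchSwinnertonDyer.BirchSwinnertonDyer.Theorems.Rank1ResidualJetDividedDescentFrame
import Summits.BirchSwinnertonDyer.BirchSwinnertonDyer.Theorems.Rank1ResidualJetDividedDescentProp82
import Summits.BirchSwinnertonDyer.BirchSwinnertonDyer.Theorems.Rank1ResidualJetDividedDescentCebotarev
import Summits.BirchSwinnertonDyer.BirchSwinnertonDyer.Theorems.Rank1ResidualJetDividedDescentClasses
import HarnessLib

/-!
# T1 JET (cell `bsd-jet`), road K — the Ш-LEVEL HALF of Jetchev's Cor. 1.5 at `p ∣ N` IN THE KERNEL: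
# `M_∞ ≥ M₀ ⟹ Ш(E/K)[p^∞] = 0` — McCallum 1991 Cor. 5.6 (`hMcU`) in the case the JET rows use,
# modulo named print {Poitou–Tate, [McC] Prop. 4.4, [GZ86 III (3.1)] = F1} only

HONEST FRAMING (programme file `BSD-LIT2PART-PROGRAMME-v1.md` §HONESTY, verbatim): «no tranche here
proves BSD; ARM L moves the LITERAL column of an r ≤ 1 census into the kernel-proved-modulo-named-print
column; ARM P changes what «named print» is worth.» THEOREMS ONLY (seat `bsd-jet-pv-1`, session g9;
`--supports stmt-BirchSwinnertonDyer-14418`, helper); nothing is booked; 0 classes move (road K is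
DOCUMENTARY). CONDITIONAL on exactly three named Literature statements, displayed:
`poitouTate_sum_localTatePairing_eq_zero K` (Poitou–Tate), `McCallum1991.prop44_localOrder_kolyvaginClass_mul_eq`
([McC] Prop. 4.4), `Gross1991_heegnerPoint_sub_ratTorsion_mem_E0` (F1). NOT claimed: McCallum's Cor. 5.6
in general (`ord_p #Ш = 2(M₀ − M_∞)`, the structure theorem) — only its extreme case.

WHAT. Every JET by-name row (`JET.bsdp_of_jetRow*`, `JET.bsdp_of_carrier*Certificate_level*`) displays
the Kolyvagin–McCallum named fact `McCallum1991_padicValNat_card_sha_primary_add_le_of_globalDivisibility`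
(`hMcU`: `ord_p #Ш(E/K)[p^∞] + 2t ≤ 2M₀` under global divisibility of the derived Heegner points to
depth `t`; size XL, flag `McCallum91-padic-image`, no `_holds`) and consumes it with `M₀ ≤ w ≤ t`, i.e.
ONLY at `t = M₀`, where it says `Ш(E/K)[p^∞] = 0`. THIS FILE proves that case in the kernel:
**`sha_primary_eq_bot_of_globalDivisibility`** — for `E/ℚ` globally minimal non-CM, `K` imaginary
quadratic (`d_K ∉ {−3,−4}`, Heegner for `N_E`), `p` odd with the `p`-adic tower onto, a frame
`(Dt, β, ι)` with a conductor-`1` datum `d₁` whose derived point is the Heegner point `P ∈ E(K)` of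
infinite order, `p^{M₀+1} ∤ P` in `E(K)`, and `p^{M₀} ∣ P_n` for every square-free `n` over
Zhang–Kolyvagin primes of index `≥ M₀` (the `s = M₀` instance of `hMcU`'s hypothesis, = Jetchev's
Thm. 1.4 output): `Ш(E/K)[p^∞] = ⊥`. PROOF = Gross 1991 §10 run on the DIVIDED Euler system
`P_n ∕ p^{M₀}` at level `p` with Kolyvagin primes of index `≥ M₀ + 1`: the frame
(`…DividedDescentFrame`: `KolyvaginDescent.Hypotheses` over a restricted Kolyvagin predicate,
`Sel_p(E/K) = ℤ · c̃(1)`, passage to `Ш`), the classes (`…DividedDescentClasses` ⟸ `h44`, `hF1`),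
Prop. 8.2 (`…DividedDescentProp82` ⟸ Poitou–Tate) and Cor. 3.2 (`…DividedDescentCebotarev`,
unconditional); `c̃(1) ≠ 0` because `p^{M₀+1} ∣ P_1` in `E(K[1])` would descend to `E(K)` (`E(K[1])` has
no `p`-torsion: `exists_zsmul_eq_of_pdiv_one`), and `c̃(1)` dies in `H¹(K, E)` because
`ι_* c̃(1) = c_{M₀+1}(1) = δ(P)` (`KolyvaginCocycle.kolyvaginClass_toGeomPoints`).
References: [cite: McCallumLMS1991, §1 Theorem (Kolyvagin), §5 Lemma 5.1, Thm. 5.4, Cor. 5.6 (p. 310)]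
[cite: GrossLMS1991, Prop. 2.3, §10, Props. 5.4 (2), 6.2, 8.2] [cite: Jetchev2008, §1 (1), Cor. 1.5
(p. 812), Thm. 1.4] [cite: GrossZagier1986, III (3.1)] [cite: MilneADT2006, Ch. I Thm. 4.10(b)].
Design: no definitions; `K : Type`. Axioms: `propext`, `Classical.choice`, `Quot.sound`.
-/

set_option autoImplicit false

noncomputable section

open scoped Classical NumberField

open WeierstrassCurve IsDedekindDomain NumberField Field Literature.NumberTheory.EllipticCurves
  Literature.NumberTheory.EllipticCurves.ModularForms Literature.NumberTheory.GaloisCohomology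
  Literature.NumberTheory.GaloisRepresentations
  Literature.NumberTheory.EllipticCurves.KolyvaginCocycle
  Summit.BirchSwinnertonDyer.Rank1Residual.X11b Summit.BirchSwinnertonDyer.Rank1Residual.X11b.Three
  Summit.BirchSwinnertonDyer.Rank1Residual.X11b.Three.Koly
  Summit.BirchSwinnertonDyer.BirchSwinnertonDyer

namespace Summit.BirchSwinnertonDyer.Rank1Residual.JET.DividedDescent

variable {K : Type} [Field K] [NumberField K] {W : WeierstrassCurve ℚ}

/-- **McCallum 1991 Lemma 5.1, descent half: `p^k ∣ P_1` in `E(K[1])` ⟹ `p^k ∣ P` in `E(K)`** when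
`E(K[1]) ⊆ E(K̄)` is admissible for `p^k` (no `p^k`-torsion) and `P_1 = d₁.derivedPoint` has the same
image in `E(K̄)` as `P ∈ E(K)`: a root `Q ∈ E(K[1])` of `P` is `Γ_K`-fixed modulo `p^k`-torsion of
`E(K[1])`, which is `0`, hence rational (`exists_toGeomPoints_eq_of_forall_smul_eq`).
[cite: McCallumLMS1991, §5 Lemma 5.1 (p. 303: "since E(K_1) has no p-torsion, E(K)/p^M E(K) injects
into E(K_1)/p^M E(K_1)")] [cite: GrossLMS1991, Lemma 4.3] -/
theorem exists_zsmul_eq_of_pdiv_one [W.IsElliptic] {N : ℕ} [NeZero N]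
    {Dt : ModularParametrizationData W N} {β : ℤ} {ι : K →+* ℂ}
    (d₁ : KolyvaginHeegnerData Dt β ι 1) {P : (W.baseChange K).toAffine.Point}
    (hP1 : d₁.toGeomPoints d₁.derivedPoint = toGeomPoints (W.baseChange K) P) {p k : ℕ}
    (hA : IsAdmissible (absoluteGaloisGroup K) d₁.pointsSubgroup ((p ^ k : ℕ) : ℤ))
    (h : PDiv d₁ p k) :
    ∃ Q : (W.baseChange K).toAffine.Point, ((p ^ k : ℕ) : ℤ) • Q = P := by
  haveI : (W.baseChange K).IsElliptic := inferInstanceAs (W.map (algebraMap ℚ K)).IsElliptic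
  haveI : PerfectField K := PerfectField.ofCharZero
  obtain ⟨Q₁, hQ₁⟩ := h
  set q : geomPoints (W.baseChange K) := d₁.toGeomPoints Q₁ with hq
  have hqA : q ∈ d₁.pointsSubgroup := ⟨Q₁, rfl⟩
  have hkq : ((p ^ k : ℕ) : ℤ) • q = toGeomPoints (W.baseChange K) P := by
    rw [hq, ← map_zsmul, hQ₁, hP1]
  -- `q` is `Γ_K`-fixed: `(g − 1) q ∈ E(K[1])` is killed by `p^k`
  have hfix : ∀ g : absoluteGaloisGroup K, g • q = q := by
    intro g
    have hmem : g • q - q ∈ d₁.pointsSubgroup :=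
      d₁.pointsSubgroup.sub_mem (hA.smul_mem g hqA) hqA
    have h0 : ((p ^ k : ℕ) : ℤ) • (g • q - q) = 0 := by
      rw [smul_sub, smul_comm, hkq, smul_toGeomPoints, sub_self]
    exact sub_eq_zero.mp (hA.eq_zero_of_zsmul hmem h0)
  obtain ⟨Q, hQ⟩ := exists_toGeomPoints_eq_of_forall_smul_eq (W.baseChange K) hfix
  refine ⟨Q, toGeomPoints_injective (W.baseChange K) ?_⟩
  rw [map_zsmul, hQ, hkq]

/-- **`M_∞ ≥ M₀ ⟹ Ш(E/K)[p^∞] = 0` — McCallum 1991 Cor. 5.6 in the case the JET rows use, IN THE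
KERNEL modulo {Poitou–Tate, [McC] Prop. 4.4, F1}.** Frame and hypotheses = those of the named fact
`McCallum1991_padicValNat_card_sha_primary_add_le_of_globalDivisibility` at `t = M₀` (`W/ℚ` globally
minimal non-CM; `K` imaginary quadratic, `d_K ∉ {−3,−4}`, Heegner for `N_E`; `p ≠ 2` with `ρ̄_{E,p^n}`
onto for all `n`; `(Dt, β, ι)`, `d₁`, `P ∈ E(K)` with the image of `P_1`, here also recorded as a
Heegner point of infinite order (`hHP`, `hnt` — the row doors carry both); `p^{M₀+1} ∤ P` in `E(K)`;
`p^{M₀} ∣ P_n` in `E(K[n])` for every square-free `n` over Zhang–Kolyvagin primes of index `≥ M₀`),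
plus the three named facts. Conclusion: the `p`-primary part of `Ш(E_K/K)` is trivial — so in
particular `ord_p #Ш(E/K)[p^∞] + 2M₀ ≤ 2M₀`, the `t = M₀` instance of `hMcU`'s conclusion.
Proof: module docstring. [cite: McCallumLMS1991, §5 Cor. 5.6, Lemma 5.1; §1 Theorem]
[cite: GrossLMS1991, Prop. 2.3, §10] [cite: Jetchev2008, §1 (1), Cor. 1.5] [cite: GrossZagier1986, III (3.1)] -/
theorem sha_primary_eq_bot_of_globalDivisibility
    (W : WeierstrassCurve ℚ) [W.IsElliptic] [W.IsGloballyMinimal] [NeZero (W.conductorNorm ℤ)]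
    (hcm : ¬ W.HasCM) (K : Type) [Field K] [NumberField K] (hK : IsImaginaryQuadratic K)
    (hD3 : NumberField.discr K ≠ -3) (hD4 : NumberField.discr K ≠ -4)
    (hH : SatisfiesHeegnerHypothesis (W.conductorNorm ℤ) K)
    (p : ℕ) [Fact p.Prime] (hp2 : p ≠ 2) (htower : ∀ n : ℕ, W.HasSurjectiveModNGaloisRep (p ^ n : ℕ))
    (Dt : ModularParametrizationData W (W.conductorNorm ℤ)) (β : ℤ) (ι : K →+* ℂ)
    (d₁ : KolyvaginHeegnerData Dt β ι 1) (P : (W.baseChange K).toAffine.Point)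
    (hP1 : d₁.toGeomPoints d₁.derivedPoint = toGeomPoints (W.baseChange K) P)
    (hHP : IsHeegnerPoint (W.conductorNorm ℤ) W K P) (hnt : ¬ IsOfFinAddOrder P)
    (M₀ : ℕ)
    (hmax : ¬ ∃ Q : (W.baseChange K).toAffine.Point, ((p ^ (M₀ + 1) : ℕ) : ℤ) • Q = P)
    (hdiv : ∀ (n : ℕ) (d : KolyvaginHeegnerData Dt β ι n), Squarefree n →
      (∀ ℓ ∈ n.primeFactors, Zhang2014.IsKolyvaginPrime (W.conductorNorm ℤ) W K p ℓ ∧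
        M₀ ≤ Zhang2014.kolyvaginIndex W p ℓ) →
      ∃ Q : (W.baseChange (ringClassField K ι n)).toAffine.Point,
        ((p ^ M₀ : ℕ) : ℤ) • Q = d.derivedPoint)
    -- NAMED PRINT
    (hPT : poitouTate_sum_localTatePairing_eq_zero K)
    (h44 : McCallum1991.prop44_localOrder_kolyvaginClass_mul_eq)
    (hF1 : Gross1991_heegnerPoint_sub_ratTorsion_mem_E0) :
    AddCommGroup.primaryComponent (W.baseChange K).sha p = ⊥ := by
  have hp : p.Prime := Fact.out
  have hρ : W.HasSurjectiveModNGaloisRep p := by simpa using htower 1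
  haveI : (W.baseChange K).IsElliptic := inferInstanceAs (W.map (algebraMap ℚ K)).IsElliptic
  have hD : NumberField.discr K < -4 := KolyvaginAssembly.discr_lt_neg_four hK ⟨hD3, hD4⟩
  obtain ⟨c, hc, -⟩ := exists_conj_of_isImaginaryQuadratic K hK
  -- `p` kills `H¹(K, E[p^1])`
  have hpn : ∀ x : galH1Torsion (W.baseChange K) ((p ^ 1 : ℕ) : ℤ), (p : ℤ) • x = 0 := fun x ↦ by
    have h := zsmul_discreteH1_torsion ((p ^ 1 : ℕ) : ℤ) x
    have e : ((p : ℕ) : ℤ) = ((p ^ 1 : ℕ) : ℤ) := by rw [pow_one]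
    rw [e]
    exact h
  -- ### the divided classes (h1) with their base class `y = c̃(1)`
  obtain ⟨y, ε, cl, hιy, hy0, hε, hc1, hcl⟩ :=
    exists_dividedClasses hcm hK hD3 hD4 hH hp2 htower h44 hF1 c hc Dt β ι d₁ M₀
      (fun n d hn hkol ↦ hdiv n d hn hkol)
  -- `y ∈ Sel_p(E/K)`: the clauses at `m = 1`
  have h1 := hcl 1 squarefree_one (fun q hq ↦ by simp at hq)
  have hySel : y ∈ selmerGroup (W.baseChange K) ((p ^ 1 : ℕ) : ℤ) := by
    rw [mem_selmerGroup_iff, ← hc1]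
    refine ⟨fun v ↦ h1.2.1 v ?_, fun w ↦ h1.2.2.1 w⟩
    rw [Nat.cast_one]
    exact fun h ↦ v.isPrime.ne_top ((Ideal.eq_top_iff_one _).mpr h)
  -- `y ≠ 0`: otherwise `p^{M₀+1} ∣ P_1` in `E(K[1])`, hence `p^{M₀+1} ∣ P` in `E(K)`
  have hA1 : IsAdmissible (absoluteGaloisGroup K) d₁.pointsSubgroup ((p ^ (M₀ + 1) : ℕ) : ℤ) :=
    RingClassNoTorsion.isAdmissible_pointsSubgroup _ hK one_ne_zero hp hp2 hρ (M₀ + 1)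
  have hyne : y ≠ 0 := fun h ↦ hmax (exists_zsmul_eq_of_pdiv_one d₁ hP1 hA1 (hy0.mp h))
  -- ### Gross's §10 over the Kolyvagin primes of index `≥ M₀ + 1`: `Sel_p(E/K) = ℤ · y`
  have hSel : selmerGroup (W.baseChange K) ((p ^ 1 : ℕ) : ℤ) = AddSubgroup.zmultiples y :=
    selmerGroup_eq_zmultiples_of_localData_of_kol (N := W.conductorNorm ℤ) hK hp hp2 hpn c
      (fun q ↦ IsKolyvaginPrime (W.conductorNorm ℤ) W K p q ∧ FrobEqFrobInfty W K (p ^ (M₀ + 1)) q ∧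
        Zhang2014.IsKolyvaginPrime (W.conductorNorm ℤ) W K p q ∧
        M₀ + 1 ≤ Zhang2014.kolyvaginIndex W p q)
      (fun q h ↦ h.1) hySel hyne ⟨ε, cl, hε, hc1, hcl⟩
      (fun hℓ _ ν hν d hd hfin hinf v hv hdv s hs hτs ↦
        prop82_levelOne_of_poitouTate hPT hcm hK ⟨hD3, hD4⟩ hH hHP hnt hp hp2 hρ hc hℓ ν hν d hd hfin
          hinf v hv hdv s hs hτs)
      (fun r cs hτ Nv hN hind b ↦ chebotarev_levelOne_shift_zhang hK hp hp2 hρ M₀ hc r cs hτ Nv hN hind b)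
  -- ### `y` dies in `H¹(K, E)`: `ι_* y = c_{M₀+1}(1) = δ P`
  have hP1inv : d₁.toGeomPoints d₁.derivedPoint ∈
      invPoints (absoluteGaloisGroup K) d₁.pointsSubgroup ((p ^ (M₀ + 1) : ℕ) : ℤ) :=
    Theorems.Prop44.toGeomPoints_derivedPoint_mem_invPoints hK ι hD hH Dt hp squarefree_one
      (fun q hq ↦ by simp at hq) d₁
  have hPinv : toGeomPoints (W.baseChange K) P ∈
      invPoints (absoluteGaloisGroup K) d₁.pointsSubgroup ((p ^ (M₀ + 1) : ℕ) : ℤ) := hP1 ▸ hP1inv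
  have hytors : torsionH1ToH1 (W.baseChange K) ((p ^ 1 : ℕ) : ℤ) y = 0 := by
    rw [← torsionH1ToH1_torsionH1OfDvd (W.baseChange K) (levelOne_dvd p M₀) y, hιy,
      d₁.kolyvaginClass_of_admissible hp (M₀ + 1) hA1 hP1inv,
      KolyvaginDescent.kolyvaginClass_congr_point hA1 (hP' := hPinv) hP1,
      kolyvaginClass_toGeomPoints hA1 P hPinv,
      torsionH1ToH1_kummerMapTorsion]
  -- ### conclusion
  exact primaryComponent_sha_eq_bot_of_selmerGroup_eq_zmultiples (W.baseChange K)
    (n := ((p ^ 1 : ℕ) : ℤ)) (by exact_mod_cast pow_ne_zero 1 hp.ne_zero)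
    (by rw [pow_one]) hytors hSel

/-- **The `hMcU`-shaped form**: under the same frame, `ord_p #Ш(E/K)[p^∞] + 2M₀ ≤ 2M₀` — the
conclusion of `McCallum1991_padicValNat_card_sha_primary_add_le_of_globalDivisibility` at `t = M₀`
(the only instance the JET row doors consume), from `sha_primary_eq_bot_of_globalDivisibility`.
[cite: McCallumLMS1991, §5 Cor. 5.6] [cite: Jetchev2008, §1 (1), Cor. 1.5] -/
theorem padicValNat_card_sha_primary_add_le_of_globalDivisibility_top
    (W : WeierstrassCurve ℚ) [W.IsElliptic] [W.IsGloballyMinimal] [NeZero (W.conductorNorm ℤ)]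
    (hcm : ¬ W.HasCM) (K : Type) [Field K] [NumberField K] (hK : IsImaginaryQuadratic K)
    (hD3 : NumberField.discr K ≠ -3) (hD4 : NumberField.discr K ≠ -4)
    (hH : SatisfiesHeegnerHypothesis (W.conductorNorm ℤ) K)
    (p : ℕ) [Fact p.Prime] (hp2 : p ≠ 2) (htower : ∀ n : ℕ, W.HasSurjectiveModNGaloisRep (p ^ n : ℕ))
    (Dt : ModularParametrizationData W (W.conductorNorm ℤ)) (β : ℤ) (ι : K →+* ℂ)
    (d₁ : KolyvaginHeegnerData Dt β ι 1) (P : (W.baseChange K).toAffine.Point)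
    (hP1 : d₁.toGeomPoints d₁.derivedPoint = toGeomPoints (W.baseChange K) P)
    (hHP : IsHeegnerPoint (W.conductorNorm ℤ) W K P) (hnt : ¬ IsOfFinAddOrder P)
    (M₀ : ℕ)
    (hmax : ¬ ∃ Q : (W.baseChange K).toAffine.Point, ((p ^ (M₀ + 1) : ℕ) : ℤ) • Q = P)
    (hdiv : ∀ (s : ℕ), s ≤ M₀ → ∀ (n : ℕ) (d : KolyvaginHeegnerData Dt β ι n), Squarefree n →
      (∀ ℓ ∈ n.primeFactors, Zhang2014.IsKolyvaginPrime (W.conductorNorm ℤ) W K p ℓ ∧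
        s ≤ Zhang2014.kolyvaginIndex W p ℓ) →
      ∃ Q : (W.baseChange (ringClassField K ι n)).toAffine.Point,
        ((p ^ s : ℕ) : ℤ) • Q = d.derivedPoint)
    (hPT : poitouTate_sum_localTatePairing_eq_zero K)
    (h44 : McCallum1991.prop44_localOrder_kolyvaginClass_mul_eq)
    (hF1 : Gross1991_heegnerPoint_sub_ratTorsion_mem_E0) :
    padicValNat p (Nat.card (AddCommGroup.primaryComponent (W.baseChange K).sha p)) + 2 * M₀ ≤
      2 * M₀ := by
  have h := sha_primary_eq_bot_of_globalDivisibility W hcm K hK hD3 hD4 hH p hp2 htower Dt β ι d₁ P hP1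
    hHP hnt M₀ hmax (hdiv M₀ le_rfl) hPT h44 hF1
  rw [h, AddSubgroup.card_bot]
  simp

end Summit.BirchSwinnertonDyer.Rank1Residual.JET.DividedDescent

end
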